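import Mathlib
import Summits.Ventures.PercRepro2.MixChordOSeparated

/-!
# The correlation decomposition of `Gc` on EVERY instance (blind cell PercRepro2, night-1 g23;
proofs/NIGHT1-G23.md §8)

The separated-`a₃` identity `Z · Gc = D · (D · I + T · J + T′ · J′)` (MixChordOSeparated.lean) used the
cleared product law for the twenty-four masses that mix the `a₃`-status with `o` or `b`.  On a GENERAL
instance the same `linear_combination` gives the exact identity

  **`Z_mul_Gc_general`**: `Z · Gc = D · (D · I + T · J + T′ · J′) + corr`,

where `corr` (`corrPart`) is a polynomial in the masses and in the SIX cleared `Q`-covariances between the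
`a₃`-status (`1_PD`, `σ₃`) and the `(o, b)`-observables — `Δ_Do = Z·P(PD, oU) − D·P(Q, oU)`,
`Δ_b3 = Z·E_Q[σ_bσ₃] − E_Q[σ₃]·E_Q[σ_b]`, `Δ_b3o`, `Δ_3o`, `Δ_PDb`, `Δ_PDbo` — each of which vanishes exactly
when `a₃` is separated from `o` and `b` by the roots.  The `o`-class row is open exactly where `corr ≠ 0`
(census: `corr < 0` on 97 / 120 random instances, so the separated part is an UPPER bound of `Z · Gc`,
not a lower bound).  Own code; standard axioms.
-/

namespace Summit.Ventures.PercRepro2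

open UnionCluster CovForm

namespace Mix

namespace Sep

section General

variable {V : Type*} {E : Type*} [Fintype E] [DecidableEq E] [DecidableEq V] {R : Type*} [Field R]

variable (p : E → R) (ends : E → Sym2 V) (o a₁ a₂ a₃ b : V)

/-- **The correlation part of `Z · Gc`**: the terms carried by the six cleared `Q`-covariances between the
`a₃`-status and the `(o, b)`-observables. -/
noncomputable def corrPart : R :=
  (prob p (avoidAll ends a₂ {a₁}) * (prob p (TEvent ends a₂ a₁ a₃ ∩ connEvent ends a₁ b) + prob p (TEvent ends a₁ a₂ a₃ ∩ connEvent ends a₂ b) - prob p (TEvent ends a₁ a₂ a₃ ∩ connEvent ends a₁ b) - prob p (TEvent ends a₂ a₁ a₃ ∩ connEvent ends a₂ b)) + (prob p (avoidAll ends a₂ {a₁} ∩ connEvent ends a₂ b) - prob p (avoidAll ends a₂ {a₁} ∩ connEvent ends a₁ b)) * (prob p (TEvent ends a₂ a₁ a₃) - prob p (TEvent ends a₁ a₂ a₃)) + prob p (avoidAll ends a₂ {a₁}) * (prob p (PDEvent ends a₁ a₂ a₃ ∩ connEvent ends a₁ b) + prob p (PDEvent ends a₁ a₂ a₃ ∩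 connEvent ends a₂ b))) * (prob p (avoidAll ends a₂ {a₁}) * (prob p (PDEvent ends a₁ a₂ a₃ ∩ connEvent ends a₁ o) + prob p (PDEvent ends a₁ a₂ a₃ ∩ connEvent ends a₂ o)) - prob p (PDEvent ends a₁ a₂ a₃) * (prob p (avoidAll ends a₂ {a₁} ∩ connEvent ends a₁ o) + prob p (avoidAll ends a₂ {a₁} ∩ connEvent ends a₂ o))) + prob p (PDEvent ends a₁ a₂ a₃) * (prob p (avoidAll ends a₂ {a₁} ∩ connEvent ends a₁ o) + prob p (avoidAll ends a₂ {a₁} ∩ connEvent ends a₂ o)) * (prob p (avoidAll ends a₂ {a₁}) * (prob p (TEvent ends a₂ a₁ a₃ ∩ connEvent ends a₁ b) + prob p (TEvent ends a₁ a₂ a₃ ∩ connEvent ends a₂ b) - prob p (TEvent ends a₁ a₂ a₃ ∩ connEvent ends a₁ b) - prob p (TEvent ends a₂ a₁ a₃ ∩ connEvent ends a₂ b)) - (prob p (TEvent ends a₂ a₁ a₃) - prob p (TEvent ends a₁ a₂ a₃)) * (prob p (avoidAll ends a₂ {a₁} ∩ connEvent ends a₁ b) - prob p (avoidAll ends a₂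 {a₁} ∩ connEvent ends a₂ b))) - prob p (avoidAll ends a₂ {a₁}) * prob p (PDEvent ends a₁ a₂ a₃) * (prob p (avoidAll ends a₂ {a₁}) * (prob p (TEvent ends a₂ a₁ a₃ ∩ (connEvent ends a₁ o ∩ connEvent ends a₁ b)) + prob p (TEvent ends a₂ a₁ a₃ ∩ (connEvent ends a₂ o ∩ connEvent ends a₁ b)) + prob p (TEvent ends a₁ a₂ a₃ ∩ (connEvent ends a₁ o ∩ connEvent ends a₂ b)) + prob p (TEvent ends a₁ a₂ a₃ ∩ (connEvent ends a₂ o ∩ connEvent ends a₂ b)) - prob p (TEvent ends a₁ a₂ a₃ ∩ (connEvent ends a₁ o ∩ connEvent ends a₁ b)) - prob p (TEvent ends a₁ a₂ a₃ ∩ (connEvent ends a₂ o ∩ connEvent ends a₁ b)) - prob p (TEvent ends a₂ a₁ a₃ ∩ (connEvent ends a₁ o ∩ connEvent ends a₂ b)) - prob p (TEvent ends a₂ a₁ a₃ ∩ (connEvent ends a₂ o ∩ connEvent ends a₂ b))) - (prob p (TEvent ends a₂ a₁ a₃) - prob p (TEvent ends a₁ a₂ a₃)) * (prob p (avoidAll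 ends a₂ {a₁} ∩ (connEvent ends a₁ o ∩ connEvent ends a₁ b)) + prob p (avoidAll ends a₂ {a₁} ∩ (connEvent ends a₂ o ∩ connEvent ends a₁ b)) - prob p (avoidAll ends a₂ {a₁} ∩ (connEvent ends a₁ o ∩ connEvent ends a₂ b)) - prob p (avoidAll ends a₂ {a₁} ∩ (connEvent ends a₂ o ∩ connEvent ends a₂ b)))) - (prob p (avoidAll ends a₂ {a₁} ∩ connEvent ends a₂ b) - prob p (avoidAll ends a₂ {a₁} ∩ connEvent ends a₁ b)) * prob p (PDEvent ends a₁ a₂ a₃) * (prob p (avoidAll ends a₂ {a₁}) * (prob p (TEvent ends a₂ a₁ a₃ ∩ connEvent ends a₁ o) + prob p (TEvent ends a₂ a₁ a₃ ∩ connEvent ends a₂ o) - prob p (TEvent ends a₁ a₂ a₃ ∩ connEvent ends a₁ o) - prob p (TEvent ends a₁ a₂ a₃ ∩ connEvent ends a₂ o)) - (prob p (TEvent ends a₂ a₁ a₃) - prob p (TEvent ends a₁ a₂ a₃)) * (prob p (avoidAll ends a₂ {a₁} ∩ connEvent ends a₁ o) + prob p (avoidAll ends a₂ {a₁} ∩ connEvent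 ends a₂ o))) + prob p (PDEvent ends a₁ a₂ a₃) * (prob p (avoidAll ends a₂ {a₁} ∩ connEvent ends a₁ o) + prob p (avoidAll ends a₂ {a₁} ∩ connEvent ends a₂ o)) * (prob p (avoidAll ends a₂ {a₁}) * (prob p (PDEvent ends a₁ a₂ a₃ ∩ connEvent ends a₁ b) + prob p (PDEvent ends a₁ a₂ a₃ ∩ connEvent ends a₂ b)) - prob p (PDEvent ends a₁ a₂ a₃) * (prob p (avoidAll ends a₂ {a₁} ∩ connEvent ends a₁ b) + prob p (avoidAll ends a₂ {a₁} ∩ connEvent ends a₂ b))) - prob p (avoidAll ends a₂ {a₁}) * prob p (PDEvent ends a₁ a₂ a₃) * (prob p (avoidAll ends a₂ {a₁}) * (prob p (PDEvent ends a₁ a₂ a₃ ∩ (connEvent ends a₁ o ∩ connEvent ends a₁ b)) + prob p (PDEvent ends a₁ a₂ a₃ ∩ (connEvent ends a₂ o ∩ connEvent ends a₁ b)) + prob p (PDEvent ends a₁ a₂ a₃ ∩ (connEvent ends a₁ o ∩ connEvent ends a₂ b)) + prob p (PDEvent ends a₁ a₂ a₃ ∩ (connEvent ends a₂ o ∩ connEvent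 ends a₂ b))) - prob p (PDEvent ends a₁ a₂ a₃) * (prob p (avoidAll ends a₂ {a₁} ∩ (connEvent ends a₁ o ∩ connEvent ends a₁ b)) + prob p (avoidAll ends a₂ {a₁} ∩ (connEvent ends a₁ o ∩ connEvent ends a₂ b)) + prob p (avoidAll ends a₂ {a₁} ∩ (connEvent ends a₂ o ∩ connEvent ends a₁ b)) + prob p (avoidAll ends a₂ {a₁} ∩ (connEvent ends a₂ o ∩ connEvent ends a₂ b))))

omit [DecidableEq V] in
/-- `gap = P(Q, bH) − P(Q, bL)` (the signs `σ_b` vanish off `Q`). -/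
lemma gap_eq_Q :
    gap p ends a₁ a₂ b =
      prob p (avoidAll ends a₂ {a₁} ∩ connEvent ends a₂ b) -
        prob p (avoidAll ends a₂ {a₁} ∩ connEvent ends a₁ b) := by
  unfold gap
  rw [← prob_inter_add_prob_inter_compl p (connEvent ends a₂ b) (avoidAll ends a₂ {a₁}),
    ← prob_inter_add_prob_inter_compl p (connEvent ends a₁ b) (avoidAll ends a₂ {a₁})]
  have hc : connEvent ends a₂ b ∩ (avoidAll ends a₂ {a₁})ᶜ = connEvent ends a₁ b ∩ (avoidAll ends a₂ {a₁})ᶜ := by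
    ext ω
    simp only [Set.mem_inter_iff, mem_connEvent, Set.mem_compl_iff, SepZero.mem_Q, not_not]
    constructor
    · rintro ⟨h1, h2⟩; exact ⟨conn_trans h2 h1, h2⟩
    · rintro ⟨h1, h2⟩; exact ⟨conn_trans (conn_symm h2) h1, h2⟩
  rw [hc, Set.inter_comm (connEvent ends a₂ b) (avoidAll ends a₂ {a₁}),
    Set.inter_comm (connEvent ends a₁ b) (avoidAll ends a₂ {a₁})]
  ring

/-- **`Z · Gc = D · (D · I + T · J + T′ · J′) + corr` on every instance.** -/
theorem Z_mul_Gc_general :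
    prob p (avoidAll ends a₂ {a₁}) * Gc p ends o a₁ a₂ a₃ b =
      prob p (PDEvent ends a₁ a₂ a₃) * (prob p (PDEvent ends a₁ a₂ a₃) * (-2 * PendantRoot.covC p ends a₁ a₂ (connEvent ends a₂ o) (connEvent ends a₁ b) - 2 * PendantRoot.covC p ends a₁ a₂ (connEvent ends a₁ o) (connEvent ends a₂ b)) + prob p (TEvent ends a₁ a₂ a₃) * (2 * PendantRoot.covC p ends a₁ a₂ (connEvent ends a₁ o) (connEvent ends a₁ b) - 2 * PendantRoot.covC p ends a₁ a₂ (connEvent ends a₁ o) (connEvent ends a₂ b)) + prob p (TEvent ends a₂ a₁ a₃) * (2 * PendantRoot.covC p ends a₁ a₂ (connEvent ends a₂ o) (connEvent ends a₂ b) - 2 * PendantRoot.covC p ends a₁ a₂ (connEvent ends a₂ o) (connEvent ends a₁ b))) + corrPart p ends o a₁ a₂ a₃ b := by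
  have hZ := Qsplit_univ p ends a₁ a₂ a₃
  have hgap := gap_eq_Q p ends a₁ a₂ b
  unfold corrPart
  simp only [Gc, EQbo, EQb3, EQb3o, EQo, EQ3, EQ3o, PDb, PDbo, Do, DEF, PendantRoot.covC]
  rw [hgap]
  linear_combination (prob p (PDEvent ends a₁ a₂ a₃) * (prob p (avoidAll ends a₂ {a₁} ∩ (connEvent ends a₁ o ∩ connEvent ends a₁ b)) + prob p (avoidAll ends a₂ {a₁} ∩ (connEvent ends a₂ o ∩ connEvent ends a₂ b)) - prob p (avoidAll ends a₂ {a₁} ∩ (connEvent ends a₂ o ∩ connEvent ends a₁ b)) - prob p (avoidAll ends a₂ {a₁} ∩ (connEvent ends a₁ o ∩ connEvent ends a₂ b))) * prob p (avoidAll ends a₂ {a₁}) - prob p (PDEvent ends a₁ a₂ a₃) * (prob p (avoidAll ends a₂ {a₁} ∩ connEvent ends a₁ b) - prob p (avoidAll ends a₂ {a₁} ∩ connEvent ends a₂ b)) * (prob p (avoidAll ends a₂ {a₁} ∩ connEvent ends a₁ o) - prob p (avoidAll ends a₂ {a₁} ∩ connEvent ends a₂ o))) * hZ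

end General

end Sep

end Mix

end Summit.Ventures.PercRepro2
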